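import Literature.Analysis.Pluripotential.PshLocalIntegrability
import Literature.Analysis.Pluripotential.NonPluripolarMongeAmpereMassSiuProofs
import HarnessLib

/-!
# Polar sets of plurisubharmonic functions are Lebesgue-null; Lelong upper level sets of every
closed positive `(1,1)`-current on `ℙᴺ(ℂ)` are null in the affine charts

Topic `Literature/Analysis/Pluripotential`. For the GENERAL current `T` of the named fact
`Siu1974_isAnalyticSet_lelongUpperLevelSet` we cannot (yet) prove analyticity of `E_c(T)`, but
the following measure-theoretic shadow of Siu's theorem holds and is proved here:

* `IsPlurisubharmonicOn.volume_setOf_eq_bot_eq_zero` — **polar sets are null**: a psh function on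
  `ℂᵐ` finite at one point is `> -∞` Lebesgue-a.e. (polydisc integrability of the negative part,
  `IsPlurisubharmonicOn.lintegral_closedBall_negPart_le_pi`, `PshLocalIntegrability.lean`);
* `IsPlurisubharmonicOn.volume_setOf_le_lelongNumber_eq_zero` — hence the Lelong upper level sets
  `{z | ν(u, z) ≥ c}`, `c > 0`, of such a function are null (a positive Lelong number forces the
  value `-∞`, `IsPlurisubharmonicOn.eq_bot_of_pos_mem_lelongSlopes`);
* `ClosedPositiveOneOneCurrent.volume_preimage_stdChartInv_lelongUpperLevelSet_eq_zero` — for every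
  closed positive `(1,1)`-current `T` on `ℙᴺ(ℂ)`, `N ≥ 1`, and `c > 0`, the trace of `E_c(T)` in each
  standard affine chart `ℂᴺ` is Lebesgue-null (as a proper analytic subset would be).

## References

* [Siu1974] Y.-T. Siu, Analyticity of sets associated to Lelong numbers and the extension of
  closed positive currents, Invent. Math. 27 (1974): Main Theorem (of which this is a weak
  consequence, proved unconditionally).
* [HormanderSCV1973] L. Hörmander, An introduction to complex analysis in several variables
  (1973), Thm. 1.6.3 and §2.6 (`u ≢ -∞` psh ⇒ `u ∈ L¹_loc`, in particular `u > -∞` a.e.).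
-/

noncomputable section

open scoped Topology ENNReal Manifold ContDiff LinearAlgebra.Projectivization
open MeasureTheory Filter Set Metric

namespace Literature.Analysis.Pluripotential

/-- **Polar sets of plurisubharmonic functions are Lebesgue-null**: if `u` is psh on `ℂᵐ` and
finite at one point `z₀`, then `{u = -∞}` has Lebesgue measure zero.
[cite: HormanderSCV1973, Thm. 1.6.3 and §2.6] -/
theorem IsPlurisubharmonicOn.volume_setOf_eq_bot_eq_zero {m : ℕ} {u : (Fin m → ℂ) → EReal}
    (hu : IsPlurisubharmonicOn u univ) {z₀ : Fin m → ℂ} (hz₀ : u z₀ ≠ ⊥) :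
    volume {z : Fin m → ℂ | u z = ⊥} = 0 := by
  -- the negative part as a `[0, ∞]`-valued measurable function
  set f : (Fin m → ℂ) → ℝ≥0∞ := fun z ↦ (-u z).toENNReal with hf
  have hfm : Measurable f := hu.measurable_of_univ.neg.ereal_toENNReal
  have hbot : ∀ z, u z = ⊥ ↔ f z = ⊤ := fun z ↦ by
    rw [hf]
    simp only [EReal.toENNReal_eq_top_iff, EReal.neg_eq_top_iff]
  -- on each polydisc around `z₀` the negative part is integrable, hence finite a.e.
  have hpoly : ∀ n : ℕ, volume ({z | u z = ⊥} ∩ closedBall z₀ (n + 1)) = 0 := by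
    intro n
    have hρ : (0 : ℝ) < n + 1 := by positivity
    -- an upper bound on the polydisc
    have hlt := sSup_image_closedBall_lt_top hu.upperSemicontinuousOn
      (fun y _ ↦ hu.lt_top (mem_univ y)) (subset_univ (closedBall z₀ ((n : ℝ) + 1)))
    obtain ⟨M, hM⟩ : ∃ M : ℝ, ∀ y ∈ closedBall z₀ ((n : ℝ) + 1), u y ≤ M := by
      rcases eq_or_ne (sSup (u '' closedBall z₀ ((n : ℝ) + 1))) ⊥ with hb | hb
      · exact ⟨0, fun y hy ↦ (le_sSup (mem_image_of_mem u hy)).trans (hb ▸ bot_le)⟩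
      · refine ⟨(sSup (u '' closedBall z₀ ((n : ℝ) + 1))).toReal, fun y hy ↦ ?_⟩
        rw [EReal.coe_toReal hlt.ne hb]
        exact le_sSup (mem_image_of_mem u hy)
    have hfin := IsPlurisubharmonicOn.lintegral_closedBall_negPart_le_pi m u hu z₀ hρ hM
    have hrhs : ((m : ℝ≥0∞) * ENNReal.ofReal (max M 0) + (-u z₀).toENNReal) *
        volume (closedBall z₀ ((n : ℝ) + 1)) < ⊤ := by
      refine ENNReal.mul_lt_top (ENNReal.add_lt_top.2 ⟨?_, ?_⟩) measure_closedBall_lt_top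
      · exact ENNReal.mul_lt_top (ENNReal.natCast_lt_top m) ENNReal.ofReal_lt_top
      · rw [lt_top_iff_ne_top, Ne, EReal.toENNReal_eq_top_iff, EReal.neg_eq_top_iff]
        exact hz₀
    -- `f < ⊤` a.e. on the polydisc
    have hae : ∀ᵐ z ∂(volume.restrict (closedBall z₀ ((n : ℝ) + 1))), f z < ⊤ :=
      ae_lt_top hfm (hfin.trans_lt hrhs).ne
    rw [ae_iff, Measure.restrict_apply' measurableSet_closedBall] at hae
    refine measure_mono_null (fun z hz ↦ ?_) hae
    exact ⟨by rw [mem_setOf_eq, not_lt, top_le_iff, ← hbot]; exact hz.1, hz.2⟩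
  -- exhaust `ℂᵐ` by the polydiscs
  have hcover : {z : Fin m → ℂ | u z = ⊥} = ⋃ n : ℕ, ({z | u z = ⊥} ∩ closedBall z₀ (n + 1)) := by
    ext z
    simp only [mem_iUnion, mem_inter_iff, mem_setOf_eq]
    constructor
    · intro hz
      obtain ⟨n, hn⟩ := exists_nat_ge (dist z z₀)
      exact ⟨n, hz, mem_closedBall.2 (hn.trans (by linarith))⟩
    · rintro ⟨n, hz, -⟩; exact hz
  rw [hcover]
  exact measure_iUnion_null hpoly

/-- **Lelong upper level sets of psh functions are null**: for `u` psh on `ℂᵐ` (`m ≥ 1`), finite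
at one point, and `c > 0`, `{z | ν(u, z) ≥ c}` has Lebesgue measure zero — a positive Lelong number
forces `u(z) = -∞`. [cite: Siu1974, Main Theorem (weak consequence); folklore] -/
theorem IsPlurisubharmonicOn.volume_setOf_le_lelongNumber_eq_zero {m : ℕ} [Nontrivial (Fin m → ℂ)]
    {u : (Fin m → ℂ) → EReal} (hu : IsPlurisubharmonicOn u univ) {z₀ : Fin m → ℂ} (hz₀ : u z₀ ≠ ⊥)
    {c : ℝ} (hc : 0 < c) : volume {z : Fin m → ℂ | c ≤ lelongNumber u z} = 0 := by
  refine measure_mono_null (fun z hz ↦ ?_) (hu.volume_setOf_eq_bot_eq_zero hz₀)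
  rw [mem_setOf_eq] at hz ⊢
  -- `c/2` is a positive admissible slope at `z`
  have hmem : c / 2 ∈ lelongSlopes u z :=
    mem_lelongSlopes_of_lt_lelongNumber (by positivity) (by linarith)
  exact hu.eq_bot_of_pos_mem_lelongSlopes (half_pos hc) hmem one_pos (subset_univ _)

namespace ClosedPositiveOneOneCurrent

variable {N : ℕ}

/-- **The Lelong upper level sets of every closed positive `(1,1)`-current on `ℙᴺ(ℂ)` are
Lebesgue-null in the affine charts**: for `N ≥ 1`, `c > 0` and every standard chart `i`, the set of
chart coordinates `w ∈ ℂᴺ` with `[w₀ : ⋯ : 1ᵢ : ⋯] ∈ E_c(T)` has measure zero. (Siu's theorem says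
much more — it is a proper analytic subset; this weak consequence holds unconditionally.)
[cite: Siu1974, Main Theorem (weak consequence)] -/
theorem volume_preimage_stdChartInv_lelongUpperLevelSet_eq_zero (T : ClosedPositiveOneOneCurrent N)
    (hN : 1 ≤ N) (i : Fin (N + 1)) {c : ℝ} (hc : 0 < c) :
    volume ((Projectivization.stdChartInv i) ⁻¹' (T.lelongUpperLevelSet c) : Set (Fin N → ℂ)) = 0 := by
  haveI : Nontrivial (Fin N → ℂ) := by
    haveI : Nonempty (Fin N) := ⟨⟨0, hN⟩⟩
    infer_instance
  -- the chart potential `gᵢ = V ∘ ιᵢ` is psh on `ℂᴺ` and finite somewhere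
  have hg := T.isPlurisubharmonicOn_pot_insertNth i
  obtain ⟨w₀, hw₀⟩ := (T.frequently_pot_insertNth_ne_bot i 0).exists
  have hset : ((Projectivization.stdChartInv i) ⁻¹' (T.lelongUpperLevelSet c) : Set (Fin N → ℂ)) =
      {w : Fin N → ℂ | c ≤ Pluripotential.lelongNumber
        (fun w' : Fin N → ℂ ↦ T.pot (Fin.insertNth i 1 w')) w} := by
    ext w
    rw [mem_preimage, T.stdChartInv_mem_lelongUpperLevelSet_iff, T.lelongNumber_pot_insertNth hN,
      mem_setOf_eq]
  rw [hset]
  exact hg.volume_setOf_le_lelongNumber_eq_zero hw₀ hc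

end ClosedPositiveOneOneCurrent

end Literature.Analysis.Pluripotential

end
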